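import Summits.ValiantsHypothesis.ValiantsHypothesis.Theorems.LangWeilTransferTameTransferModelCount
import Summits.ValiantsHypothesis.ValiantsHypothesis.Theorems.LangWeilTransferTameTransferModelPoints
import Literature.RingTheory.NoetherNormalization.HypersurfaceModel

/-!
# LangWeilTransfer — the ALGEBRAIC HALF of `TameResolution` (stmt-6378) holds: every minimal
# prime has an integer congruence model (no degree / weight bounds)

Route `LangWeilTransfer` of `ValiantsHypothesis`; `TameResolution` is the last open input of the
crux `TameTransfer` (stmt-6373, Theorem T). `TameResolution` = (algebraic data: `r ≤ m`, an integer
hypersurface model `Q` with constant leading coefficient, positive degree, irreducible over `ℚ`,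
the component-count inequality over `ℚ̄`, the point condition over `ℚ̄` through `V/ρ`) +
(degree and log-weight bounds). This file proves the algebraic data EXIST for every minimal prime
(`exists_algebraic_resolution`), unconditionally and with no bounds, by combining

* the tree's birational hypersurface model of an affine variety over a perfect field
  (`Literature.RingTheory.NoetherNormalization.HypersurfaceModel.nonempty`: a separating
  transcendence basis among the coordinates, a primitive element made integral, its monic minimal
  polynomial `m`, denominators `δ` and numerators `w_j` with `δ(y) x_j ≡ w_j(y, u)`),
* clearing denominators to `ℤ` (`exists_int_model`),
* and the `ℚ̄`-conjuncts from congruences (`ncard_minimalPrimes_model_le_int`,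
  `forall_aeval_div_eq_zero_int` of this route's (C)-files).

So what remains of stmt-6378 is EXACTLY the quantitative part: producing such a model inside the
envelope `deg ≤ (d+2)^{a(m+1)}`, `log₂ wt ≤ (d+2)^{a(m+1)} (log₂ w + log₂ t + 2)^a`
(`tameResolution_of_congruenceModels`). Honest framing: a support item of a conditional route,
bounds NOT proved here; VP ≠ VNP is NOT proved and nothing here bears on it.
-/

noncomputable section

open MvPolynomial Polynomial

-- the summit and the problem share the name `ValiantsHypothesis` (D-0017 single-conjunct layout)
set_option linter.dupNamespace false

namespace Summit.ValiantsHypothesis.ValiantsHypothesis.Theorems.LangWeilTransfer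

open Literature.RingTheory.NoetherNormalization

/-! ## Reading a `HypersurfaceModel` in the `Fin.cons` / `finSuccEquiv` conventions -/

section ReadModel

variable {K : Type*} [Field K] {n d : ℕ}

/-- `subst emb U q = (finSuccEquiv⁻¹ q)(U, X ∘ emb)`: the substitution of `HypersurfaceModel` is the
evaluation of the corresponding polynomial in `K[X₀, X₁, …, X_d]` at `X₀ ↦ U`, `Xᵢ ↦ X_{emb i}`. -/
theorem subst_eq_aeval_cons (emb : Fin d ↪ Fin n) (U : MvPolynomial (Fin n) K)
    (q : (MvPolynomial (Fin d) K)[X]) :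
    subst emb U q = MvPolynomial.aeval (Fin.cons U (fun i => X (emb i)) : Fin (d + 1) → MvPolynomial (Fin n) K)
      ((finSuccEquiv K d).symm q) := by
  rw [Literature.AlgebraicGeometry.Motives.TwoPointPencil.aeval_cons_eq_aevalTower,
    AlgEquiv.apply_symm_apply]
  have hre : (rename emb : MvPolynomial (Fin d) K →ₐ[K] MvPolynomial (Fin n) K) =
      MvPolynomial.aeval (fun i => X (emb i)) :=
    MvPolynomial.algHom_ext fun i => by rw [rename_X, MvPolynomial.aeval_X]
  unfold subst
  rw [hre]
  rfl

/-- The algebraic independence of the chosen coordinates modulo `P`, in Mathlib's form. -/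
theorem algebraicIndependent_mk_X_emb (P : Ideal (MvPolynomial (Fin n) K)) [P.IsPrime]
    (M : HypersurfaceModel P) :
    AlgebraicIndependent K fun i => Ideal.Quotient.mk P (X (M.emb i)) := by
  rw [algebraicIndependent_iff_injective_aeval, injective_iff_map_eq_zero]
  intro q hq
  apply M.eq_zero_of_rename_mem q
  have h : (MvPolynomial.aeval fun i => Ideal.Quotient.mk P (X (M.emb i))) =
      (Ideal.Quotient.mkₐ K P).comp (rename M.emb) := by
    have hre : (rename M.emb : MvPolynomial (Fin M.d) K →ₐ[K] MvPolynomial (Fin n) K) =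
        MvPolynomial.aeval (fun i => X (M.emb i)) :=
      MvPolynomial.algHom_ext fun i => by rw [rename_X, MvPolynomial.aeval_X]
    rw [hre, MvPolynomial.comp_aeval]
    rfl
  rw [h] at hq
  exact Ideal.Quotient.eq_zero_iff_mem.mp hq

end ReadModel

/-! ## Clearing denominators -/

/-- **Clearing denominators**: every `p ∈ ℚ[X_σ]` is `D⁻¹ p'` with `p' ∈ ℤ[X_σ]`, `D ∈ ℤ ∖ {0}`. -/
theorem exists_int_model {σ : Type*} (p : MvPolynomial σ ℚ) :
    ∃ (D : ℤ) (p' : MvPolynomial σ ℤ), D ≠ 0 ∧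
      MvPolynomial.map (Int.castRingHom ℚ) p' = MvPolynomial.C (D : ℚ) * p := by
  classical
  set D : ℤ := ∏ e ∈ p.support, ((p.coeff e).den : ℤ) with hD
  have hD0 : D ≠ 0 := Finset.prod_ne_zero_iff.2 fun e _ => by exact_mod_cast (p.coeff e).den_nz
  have hint : ∀ e, ∃ z : ℤ, (D : ℚ) * p.coeff e = z := by
    intro e
    by_cases he : e ∈ p.support
    · obtain ⟨E, hE⟩ : ((p.coeff e).den : ℤ) ∣ D := Finset.dvd_prod_of_mem _ he
      refine ⟨E * (p.coeff e).num, ?_⟩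
      rw [hE]
      push_cast
      have := Rat.mul_den_eq_num (p.coeff e)
      calc ((p.coeff e).den : ℚ) * E * p.coeff e = E * (p.coeff e * (p.coeff e).den) := by ring
        _ = E * (p.coeff e).num := by rw [this]
    · rw [MvPolynomial.notMem_support_iff.1 he, mul_zero]
      exact ⟨0, by simp⟩
  choose z hz using hint
  refine ⟨D, ∑ e ∈ p.support, monomial e (z e), hD0, ?_⟩
  rw [map_sum]
  conv_rhs => rw [p.as_sum, Finset.mul_sum]
  refine Finset.sum_congr rfl fun e _ => ?_
  rw [MvPolynomial.map_monomial, MvPolynomial.C_mul_monomial, eq_intCast, ← hz e]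

/-- Clearing denominators for a finite family with one common denominator. -/
theorem exists_int_models {σ : Type*} {ι : Type*} [Fintype ι] (p : ι → MvPolynomial σ ℚ) :
    ∃ (D : ℤ) (p' : ι → MvPolynomial σ ℤ), D ≠ 0 ∧
      ∀ i, MvPolynomial.map (Int.castRingHom ℚ) (p' i) = MvPolynomial.C (D : ℚ) * p i := by
  classical
  choose D p' hD hp using fun i => exists_int_model (p i)
  refine ⟨∏ i, D i, fun i => MvPolynomial.C (∏ j ∈ Finset.univ.erase i, D j) * p' i,
    Finset.prod_ne_zero_iff.2 fun i _ => hD i, fun i => ?_⟩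
  rw [map_mul, MvPolynomial.map_C, hp i, ← mul_assoc, ← MvPolynomial.C_mul, eq_intCast,
    ← Finset.prod_erase_mul _ _ (Finset.mem_univ i)]
  push_cast
  ring

/-! ## The algebraic half of `TameResolution` -/

/-- **Every minimal prime has an integer congruence model** (the algebraic half of
`TameResolution`, no bounds). For an integer system `S` in `m` unknowns and a minimal prime `𝔭`
of its `ℚ`-ideal there are `r ≤ m`, `ℓ : Fin r → ℚ[Y]` algebraically independent modulo `𝔭`
(here: a subset of the coordinates), `u ∈ ℚ[Y]`, an integer `Q ∈ ℤ[X₀..X_r]` with constant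
non-zero leading `X₀`-coefficient `cQ`, positive `X₀`-degree, irreducible over `ℚ`, with
`Q(u, ℓ) ∈ 𝔭`, and `ρ ∈ ℤ[X₁..X_r] ∖ 0`, `V : Fin m → ℤ[X₀..X_r]` with the congruences
`ρ(ℓ) Y_j - V_j(u, ℓ) ∈ 𝔭`. (From the tree's `HypersurfaceModel` over the perfect field `ℚ`,
denominators cleared.) -/
theorem exists_congruence_model {m t : ℕ} (S : Fin t → MvPolynomial (Fin m) ℤ)
    (𝔭 : Ideal (MvPolynomial (Fin m) ℚ))
    (h𝔭 : 𝔭 ∈ (Ideal.span (Set.range fun i => MvPolynomial.map (Int.castRingHom ℚ) (S i))).minimalPrimes) :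
    ∃ (r : ℕ) (ℓ : Fin r → MvPolynomial (Fin m) ℚ) (u : MvPolynomial (Fin m) ℚ)
      (Q : MvPolynomial (Fin (r + 1)) ℤ) (ρ : MvPolynomial (Fin r) ℤ)
      (V : Fin m → MvPolynomial (Fin (r + 1)) ℤ) (cQ : ℤ),
      r ≤ m ∧ cQ ≠ 0 ∧ ρ ≠ 0 ∧ (MvPolynomial.finSuccEquiv ℤ r Q).leadingCoeff = MvPolynomial.C cQ ∧
      0 < (MvPolynomial.finSuccEquiv ℤ r Q).natDegree ∧
      Irreducible (MvPolynomial.map (Int.castRingHom ℚ) Q) ∧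
      AlgebraicIndependent ℚ (fun i => Ideal.Quotient.mk 𝔭 (ℓ i)) ∧
      MvPolynomial.aeval (Fin.cons u ℓ : Fin (r + 1) → MvPolynomial (Fin m) ℚ)
        (MvPolynomial.map (Int.castRingHom ℚ) Q) ∈ 𝔭 ∧
      ∀ j, MvPolynomial.aeval ℓ (MvPolynomial.map (Int.castRingHom ℚ) ρ) * X j -
        MvPolynomial.aeval (Fin.cons u ℓ : Fin (r + 1) → MvPolynomial (Fin m) ℚ)
          (MvPolynomial.map (Int.castRingHom ℚ) (V j)) ∈ 𝔭 := by
  classical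
  haveI : 𝔭.IsPrime := h𝔭.1.1
  obtain ⟨M⟩ := HypersurfaceModel.nonempty 𝔭
  -- the rational data
  set r := M.d with hr
  set ℓ : Fin r → MvPolynomial (Fin m) ℚ := fun i => X (M.emb i) with hℓ
  set u : MvPolynomial (Fin m) ℚ := M.U with hu
  set Qℚ : MvPolynomial (Fin (r + 1)) ℚ := (finSuccEquiv ℚ r).symm M.m with hQℚ
  have hQℚ' : finSuccEquiv ℚ r Qℚ = M.m := by rw [hQℚ, AlgEquiv.apply_symm_apply]
  have hind : AlgebraicIndependent ℚ fun i => Ideal.Quotient.mk 𝔭 (ℓ i) :=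
    algebraicIndependent_mk_X_emb 𝔭 M
  have hrootℚ : MvPolynomial.aeval (Fin.cons u ℓ : Fin (r + 1) → MvPolynomial (Fin m) ℚ) Qℚ ∈ 𝔭 := by
    rw [hQℚ, ← subst_eq_aeval_cons]
    exact M.subst_m_mem
  have hVℚ : ∀ j, MvPolynomial.aeval ℓ M.δ * X j -
      MvPolynomial.aeval (Fin.cons u ℓ : Fin (r + 1) → MvPolynomial (Fin m) ℚ)
        ((finSuccEquiv ℚ r).symm (M.w j)) ∈ 𝔭 := by
    intro j
    rw [← subst_eq_aeval_cons]
    have hre : (rename M.emb : MvPolynomial (Fin r) ℚ →ₐ[ℚ] MvPolynomial (Fin m) ℚ) =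
        MvPolynomial.aeval ℓ :=
      MvPolynomial.algHom_ext fun i => by rw [rename_X, hℓ, MvPolynomial.aeval_X]
    have h := M.graph_mem j
    rwa [hre] at h
  -- integer models
  obtain ⟨D, Q, hD, hQ⟩ := exists_int_model Qℚ
  obtain ⟨E, ρ', hE, hρ'⟩ := exists_int_model M.δ
  obtain ⟨E', V', hE', hV'⟩ := exists_int_models fun j => (finSuccEquiv ℚ r).symm (M.w j)
  set ρ : MvPolynomial (Fin r) ℤ := MvPolynomial.C E' * ρ' with hρ
  set V : Fin m → MvPolynomial (Fin (r + 1)) ℤ := fun j => MvPolynomial.C E * V' j with hV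
  have hρmap : MvPolynomial.map (Int.castRingHom ℚ) ρ = MvPolynomial.C ((E' : ℚ) * E) * M.δ := by
    rw [hρ, map_mul, MvPolynomial.map_C, hρ', ← mul_assoc, ← MvPolynomial.C_mul, eq_intCast]
  have hVmap : ∀ j, MvPolynomial.map (Int.castRingHom ℚ) (V j) =
      MvPolynomial.C ((E' : ℚ) * E) * (finSuccEquiv ℚ r).symm (M.w j) := by
    intro j
    rw [hV]
    dsimp only
    rw [map_mul, MvPolynomial.map_C, hV' j, ← mul_assoc, ← MvPolynomial.C_mul, eq_intCast,
      mul_comm (E : ℚ)]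
  have hinj : Function.Injective (MvPolynomial.map (σ := Fin r) (Int.castRingHom ℚ)) :=
    MvPolynomial.map_injective _ (Int.castRingHom ℚ).injective_int
  -- the image of `finSuccEquiv ℤ r Q` over `ℚ` is `C D • m`
  have hfse : Polynomial.map (MvPolynomial.map (Int.castRingHom ℚ)) (finSuccEquiv ℤ r Q) =
      Polynomial.C (MvPolynomial.C (D : ℚ)) * M.m := by
    rw [← Literature.AlgebraicGeometry.Motives.TwoPointPencil.finSuccEquiv_map, hQ, map_mul, hQℚ',
      finSuccEquiv_apply, eval₂Hom_C, RingHom.comp_apply]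
  have hDℚ : (D : ℚ) ≠ 0 := Int.cast_ne_zero.mpr hD
  have hCD : (Polynomial.C (MvPolynomial.C (D : ℚ)) : (MvPolynomial (Fin r) ℚ)[X]).leadingCoeff *
      M.m.leadingCoeff ≠ 0 := by
    rw [Polynomial.leadingCoeff_C, M.monic.leadingCoeff, mul_one]
    exact (MvPolynomial.C_ne_zero (σ := Fin r)).mpr hDℚ
  refine ⟨r, ℓ, u, Q, ρ, V, D, ?_, hD, ?_, ?_, ?_, ?_, hind, ?_, ?_⟩
  · -- `r ≤ m`
    simpa [Fintype.card_fin] using Fintype.card_le_of_embedding M.emb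
  · -- `ρ ≠ 0`
    intro h0
    have := hρmap
    rw [h0, map_zero] at this
    exact (mul_ne_zero ((MvPolynomial.C_ne_zero (σ := Fin r)).mpr
      (mul_ne_zero (Int.cast_ne_zero.mpr hE') (Int.cast_ne_zero.mpr hE))) M.δ_ne_zero) this.symm
  · -- leading coefficient `C D`
    apply hinj
    rw [← Polynomial.leadingCoeff_map_of_injective hinj, hfse, Polynomial.leadingCoeff_mul' hCD,
      Polynomial.leadingCoeff_C, M.monic.leadingCoeff, mul_one, MvPolynomial.map_C, eq_intCast]
  · -- positive degree
    rw [← Polynomial.natDegree_map_eq_of_injective hinj, hfse, Polynomial.natDegree_mul' hCD,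
      Polynomial.natDegree_C, zero_add]
    exact M.natDegree_pos
  · -- irreducible over `ℚ`
    rw [hQ]
    have hunit : IsUnit (MvPolynomial.C (D : ℚ) : MvPolynomial (Fin (r + 1)) ℚ) :=
      (isUnit_iff_ne_zero.mpr hDℚ).map MvPolynomial.C
    exact (irreducible_isUnit_mul hunit).mpr
      ((MulEquiv.irreducible_iff (finSuccEquiv ℚ r).symm).mpr M.irreducible)
  · -- `Q(u, ℓ) ∈ 𝔭`
    rw [hQ, map_mul]
    exact 𝔭.mul_mem_left _ hrootℚ
  · -- the congruences
    intro j
    rw [hρmap, hVmap, map_mul (MvPolynomial.aeval ℓ),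
      map_mul (MvPolynomial.aeval (Fin.cons u ℓ : Fin (r + 1) → MvPolynomial (Fin m) ℚ)),
      MvPolynomial.aeval_C, MvPolynomial.aeval_C, mul_assoc, ← mul_sub]
    exact 𝔭.mul_mem_left _ (hVℚ j)

/-- **The algebraic half of `TameResolution`**: for every integer system `S` and every minimal
prime `𝔭` of its `ℚ`-ideal, ALL conjuncts of `TameResolution` except the degree / log-weight
bounds hold for some integer model `(r, Q, ρ, V, cQ)` — including the two conjuncts over `ℚ̄`
(component count, points through `V/ρ`). Unconditional. -/
theorem exists_algebraic_resolution {m t : ℕ} (S : Fin t → MvPolynomial (Fin m) ℤ)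
    (𝔭 : Ideal (MvPolynomial (Fin m) ℚ))
    (h𝔭 : 𝔭 ∈ (Ideal.span (Set.range fun i => MvPolynomial.map (Int.castRingHom ℚ) (S i))).minimalPrimes) :
    ∃ (r : ℕ) (Q : MvPolynomial (Fin (r + 1)) ℤ) (ρ : MvPolynomial (Fin r) ℤ)
      (V : Fin m → MvPolynomial (Fin (r + 1)) ℤ) (cQ : ℤ),
      r ≤ m ∧ cQ ≠ 0 ∧ ρ ≠ 0 ∧ (MvPolynomial.finSuccEquiv ℤ r Q).leadingCoeff = MvPolynomial.C cQ ∧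
      0 < (MvPolynomial.finSuccEquiv ℤ r Q).natDegree ∧
      Irreducible (MvPolynomial.map (Int.castRingHom ℚ) Q) ∧
      ((Ideal.map (MvPolynomial.map (algebraMap ℚ (AlgebraicClosure ℚ)))
          (Ideal.span {MvPolynomial.map (Int.castRingHom ℚ) Q})).minimalPrimes).ncard ≤
        ((Ideal.map (MvPolynomial.map (algebraMap ℚ (AlgebraicClosure ℚ))) 𝔭).minimalPrimes).ncard ∧
      (∀ x : Fin (r + 1) → AlgebraicClosure ℚ, MvPolynomial.aeval x Q = 0 →
        MvPolynomial.aeval (x ∘ Fin.succ) ρ ≠ 0 →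
        ∀ i, MvPolynomial.aeval (fun j => MvPolynomial.aeval x (V j) / MvPolynomial.aeval (x ∘ Fin.succ) ρ)
          (S i) = 0) := by
  haveI : 𝔭.IsPrime := h𝔭.1.1
  obtain ⟨r, ℓ, u, Q, ρ, V, cQ, hr, hcQ, hρ, hlc, hdeg, hirr, hind, hroot, hV⟩ :=
    exists_congruence_model S 𝔭 h𝔭
  have hS : ∀ i, MvPolynomial.map (Int.castRingHom ℚ) (S i) ∈ 𝔭 := fun i =>
    h𝔭.1.2 (Ideal.subset_span (Set.mem_range_self i))
  exact ⟨r, Q, ρ, V, cQ, hr, hcQ, hρ, hlc, hdeg, hirr,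
    ncard_minimalPrimes_model_le_int 𝔭 ℓ u hind Q cQ hcQ hlc hirr hroot,
    forall_aeval_div_eq_zero_int 𝔭 ℓ u hind Q cQ hcQ hlc hirr hroot ρ hρ V hV S hS⟩

end Summit.ValiantsHypothesis.ValiantsHypothesis.Theorems.LangWeilTransfer

end
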